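/-
Copyright (c) 2026 the pub-hodgecm-mathlib formalisation cell (harness21).  Prover seat hodgecm-mathlib-K2E3-p27 (g4), Track B «K2-LIT», h413 = `stmt-HodgeConjecture-24833`,
route `HCCMUnconditional`, R90-TF S8; S8 dealer R90-CS-plan (g4) S8-R295 (3) ∕ S8-R304: brick X1-α of the #4′ top-row self-dual letter (census `K2/K2E3-p27/g4/CENSUS-X1-topRow.K2E3-p27-g4.md`
0dac5aacfe2fef50) — the GENERIC HILBERT-SPACE STEP: atom vectors of an isometric block model as limits, and the pure-atom part is their span.
-/
import Mathlib.Analysis.InnerProductSpace.PiL2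
import Mathlib.Analysis.Normed.Lp.ProdLp
import Mathlib.Analysis.Normed.Operator.LinearIsometry
import HarnessLib

/-!
# S8 #4′ road — `R90S8AtomVectorsOfIsometryLimitU2` (X1-α): THE ATOM VECTORS OF AN ISOMETRIC BLOCK MODEL AND THE SPAN OF THE PURE-ATOM PART (generic Hilbert-space lemma)

Track B ∕ K2-LIT, crux h413 = `stmt-HodgeConjecture-24833`, route of record `HCCMUnconditional`; cell `hodgecm-mathlib`, R90-TF S8 «ContSpec-n½», socket #4′
`sock_S8_resH_spannedByCharLines` (B ED. 7 :494), TOP ROW `(K_max, 1)`, self-dual letter «`∃ V, (N_blk)(V) ∧ resHAtom V ≤ ⨆_ψ ℂ·[ψ∘det]`», brick (X1) «the pure-atom vectors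
`Sc ⊓ ker (snd ∘ V)` are spanned by NAMED residue vectors».  THEOREMS ONLY (no `def`, no `instance`, no `notation`, no named-fact hypothesis, no `sorry`; default heartbeats); lane
`--supports stmt-HodgeConjecture-24833 --as helper` (count-neutral).  CLOSES NO SOCKET.  GENERIC functional analysis (pure Mathlib), no automorphic object.

THE MATHEMATICS ([ReedSimonI1980, Thm. I.3 (completeness), §II.1]; [MoeglinWaldspurger1995, IV.1.11 — residues as limits of pseudo-Eisenstein series]).  Let `U : G →ₗᵢ 𝓜` be a linear ISOMETRY
of a complete inner-product space `G` (the block `Sc`) into the model `𝓜 = (⊕_{c ∈ S} W) ⊕₂ Λ` (atoms × line; ★ M1's `WithLp 2 (PiLp 2 (S → W) × Lp W 2 …)`).  Suppose that for every atom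
slot `c` there is a sequence `g_n ∈ G` whose images converge to a PURE ATOM `x_c` (line coordinate `0`, atom coordinates `Pi.single c (a c)`) — in the application `g_n = [θ_{f_n,φ₀}]` for Mellin
profiles concentrating at the pole `c` (★ K2E1-p12 `exists_mellinProfiles_concentrating`, brick X1-β) — and that every image `U y` has its `c`-coordinate on the line `ℂ·a c` (true on the
bricks, `r′_f c = √C·M[f](−c)·T_c v`, and closed).  Then: (i) `g_n` is Cauchy (`U` is an isometry), so it converges in the complete `G` to a vector `R c` with `U (R c) = x_c` — THE ATOM VECTOR at
`c` (the residue class up to a scalar, X2's target); (ii) every `y ∈ G` with vanishing line coordinate satisfies `U y = Σ_c t_c • U (R c)` coordinatewise, hence `y = Σ_c t_c • R c` by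
injectivity: the pure-atom part is `span {R c}`.
* §1 `exists_lim_of_tendsto_isometry` — a sequence whose isometric images converge has a limit with the expected image.
* §2 **`exists_atomVectors_of_tendsto`** — THE HEAD: `∃ R : S → G, (∀ c, U (R c) = x c) ∧ ∀ y, (U y).2 = 0 → y ∈ span (range R)`.
* §3 `forall_coord_mem_span_singleton_of_dense` — §2's coordinate hypothesis from a set with dense span (the bricks).
HONEST LABEL: HC_CM is proved only modulo the 7 printed citations (2 remaining named inputs: hLiu418 = `stmt-HodgeConjecture-24832`, h413 = `stmt-HodgeConjecture-24833`) until rung 0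
closes; generic leaf, pays nothing by itself (X1-β, X1-γ, X2 remain); count-neutral; unconditional.

## References
* [ReedSimonI1980] M. Reed, B. Simon, *Methods of Modern Mathematical Physics I: Functional Analysis* (1980), Thm. I.3, §II.1.
* [MoeglinWaldspurger1995] C. Mœglin, J.-L. Waldspurger, *Spectral Decomposition and Eisenstein Series* (1995), IV.1.11.
-/

set_option autoImplicit false
set_option linter.dupNamespace false  -- the mandated namespace `…HodgeConjecture.HodgeConjecture.R90.S8` (LEAD #1 L1) repeats the summit's segment

noncomputable section

open Filter Topology
open scoped BigOperators

namespace Summit.HodgeConjecture.HodgeConjecture.R90.S8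

section Generic

variable {G : Type*} [NormedAddCommGroup G] [NormedSpace ℂ G] [CompleteSpace G]
  {M : Type*} [NormedAddCommGroup M] [NormedSpace ℂ M]

/-! ## §1 A sequence whose isometric images converge has a limit -/

/-- **Limits through an isometry**: if `U : G →ₗᵢ M` is a linear isometry of a COMPLETE space and `U (g n) → x`, then `g n → R` for some `R` with `U R = x` (the images are Cauchy, so the
sequence is Cauchy; continuity and uniqueness of limits). [cite: ReedSimonI1980, Thm. I.3] -/
theorem exists_lim_of_tendsto_isometry (U : G →ₗᵢ[ℂ] M) {g : ℕ → G} {x : M} (hg : Tendsto (fun n => U (g n)) atTop (𝓝 x)) :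
    ∃ R : G, Tendsto g atTop (𝓝 R) ∧ U R = x := by
  have h1 : Cauchy (Filter.map U (Filter.map g atTop)) := by
    rw [Filter.map_map]
    exact hg.cauchySeq
  have hC : CauchySeq g := U.isometry.isUniformInducing.cauchy_map_iff.1 h1
  obtain ⟨R, hR⟩ := cauchySeq_tendsto_of_complete hC
  exact ⟨R, hR, tendsto_nhds_unique ((U.continuous.tendsto R).comp hR) hg⟩

end Generic

/-! ## §2 Atom vectors and the span of the pure-atom part -/

section Atoms

variable {G : Type*} [NormedAddCommGroup G] [NormedSpace ℂ G] [CompleteSpace G]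
  {S : Type*} [Fintype S] [DecidableEq S]
  {W : Type*} [NormedAddCommGroup W] [NormedSpace ℂ W]
  {Λ : Type*} [NormedAddCommGroup Λ] [NormedSpace ℂ Λ]

/-- **THE ATOM VECTORS OF AN ISOMETRIC BLOCK MODEL (X1-α).**  `U : G →ₗᵢ (⊕_{c∈S} W) ⊕₂ Λ` a linear isometry of a complete space; `a : S → W` the atom directions; for every slot `c`
a sequence `g c n ∈ G` with `U (g c n) → x c`, where `x c` is the PURE ATOM with atom coordinates `Pi.single c (a c)` and line coordinate `0` (`hx1`, `hx2`); and every image `U y` has its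
`c`-coordinate on the line `ℂ·a c` (`hcoord`).  THEN there are ATOM VECTORS `R c ∈ G` with `U (R c) = x c` (§1), and every `y` with vanishing line coordinate lies in `span {R c}` — for
`(U y).1 c = t c • a c` one has `U y = U (Σ_c t c • R c)` coordinate by coordinate, and `U` is injective.  In the #4′ application `G = Sc(K_max, 1, χ)`, `U` = ★ M1's sqrt isometry,
`g c n = [θ_{f_n,φ₀}]` (concentrating Mellin profiles, X1-β), `a c = √C·T_c v`, and `{y ∣ (U y).2 = 0} = resHAtom`. [cite: ReedSimonI1980, Thm. I.3, §II.1] [cite: MoeglinWaldspurger1995, IV.1.11] -/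
theorem exists_atomVectors_of_tendsto
    (U : G →ₗᵢ[ℂ] WithLp 2 (PiLp 2 (fun _ : S => W) × Λ)) (a : S → W)
    (x : S → WithLp 2 (PiLp 2 (fun _ : S => W) × Λ))
    (hx1 : ∀ c c' : S, (WithLp.ofLp (x c)).1 c' = (Pi.single c (a c) : S → W) c') (hx2 : ∀ c : S, (WithLp.ofLp (x c)).2 = 0)
    (g : S → ℕ → G) (hg : ∀ c : S, Tendsto (fun n => U (g c n)) atTop (𝓝 (x c)))
    (hcoord : ∀ (y : G) (c : S), ∃ t : ℂ, (WithLp.ofLp (U y)).1 c = t • a c) :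
    ∃ R : S → G, (∀ c, U (R c) = x c) ∧
      ∀ y : G, (WithLp.ofLp (U y)).2 = 0 → y ∈ Submodule.span ℂ (Set.range R) := by
  classical
  -- (i) the atom vectors
  have key : ∀ c : S, ∃ R : G, U R = x c := fun c => by
    obtain ⟨R, -, hR⟩ := exists_lim_of_tendsto_isometry U (hg c)
    exact ⟨R, hR⟩
  choose R hR using key
  refine ⟨R, hR, fun y hy => ?_⟩
  -- (ii) the coordinates of `U y`
  choose t ht using hcoord y
  -- `U y = Σ_c t c • x c` coordinate by coordinate
  have hUy : U y = ∑ c, t c • x c := by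
    refine (WithLp.ext_iff _).2 (Prod.ext ?_ ?_)
    · -- atom coordinates
      apply PiLp.ext
      intro c'
      have hR' : (WithLp.ofLp (∑ c, t c • x c)).1 c' = ∑ c, t c • (WithLp.ofLp (x c)).1 c' := by
        rw [WithLp.ofLp_sum, Prod.fst_sum, WithLp.ofLp_sum, Finset.sum_apply]
        refine Finset.sum_congr rfl fun c _ => ?_
        rw [WithLp.ofLp_smul, Prod.smul_fst, WithLp.ofLp_smul, Pi.smul_apply]
      rw [hR', ht c']
      simp_rw [hx1, Pi.single_apply, smul_ite, smul_zero]
      rw [Finset.sum_ite_eq, if_pos (Finset.mem_univ _)]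
    · -- line coordinate
      have hR' : (WithLp.ofLp (∑ c, t c • x c)).2 = ∑ c, t c • (WithLp.ofLp (x c)).2 := by
        rw [WithLp.ofLp_sum, Prod.snd_sum]
        refine Finset.sum_congr rfl fun c _ => ?_
        rw [WithLp.ofLp_smul, Prod.smul_snd]
      rw [hR', hy]
      simp_rw [hx2, smul_zero, Finset.sum_const_zero]
  have hsum : U y = U (∑ c, t c • R c) := by
    rw [map_sum]
    simp_rw [U.map_smul, hR]
    exact hUy
  exact (U.injective hsum).symm ▸ Submodule.sum_mem _ fun c _ => Submodule.smul_mem _ _ (Submodule.subset_span ⟨c, rfl⟩)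

/-! ## §3 The coordinate hypothesis from a generating set -/

omit [CompleteSpace G] [DecidableEq S] in
/-- **The coordinate hypothesis of §2 from a dense generating set**: if the images of a set `s ⊆ G` with DENSE span have their `c`-coordinate on the line `ℂ·a c`, then so does every image —
the condition defines the preimage of the closed (one-dimensional) submodule `ℂ·a c` under the continuous linear map `y ↦ (U y).1 c`, a closed submodule containing `span s`.  (In the #4′
application `s` = the bricks `[θ_{f,φ₀}]`, whose atom coordinates are `√C·M[f](−c)·T_c v`.) [cite: ReedSimonI1980, §II.1] -/
theorem forall_coord_mem_span_singleton_of_dense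
    (U : G →ₗᵢ[ℂ] WithLp 2 (PiLp 2 (fun _ : S => W) × Λ)) (a : S → W) (c : S) {s : Set G}
    (hs : (Submodule.span ℂ s).topologicalClosure = ⊤)
    (h : ∀ y ∈ s, ∃ t : ℂ, (WithLp.ofLp (U y)).1 c = t • a c) :
    ∀ y : G, ∃ t : ℂ, (WithLp.ofLp (U y)).1 c = t • a c := by
  -- the linear map `y ↦ (U y).1 c` and the preimage of the line `ℂ ∙ a c`
  let L : G →ₗ[ℂ] W :=
    { toFun := fun y => (WithLp.ofLp (U y)).1 c
      map_add' := fun y z => by rw [map_add, WithLp.ofLp_add, Prod.fst_add, WithLp.ofLp_add, Pi.add_apply]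
      map_smul' := fun r y => by rw [LinearIsometry.map_smul, WithLp.ofLp_smul, Prod.smul_fst, WithLp.ofLp_smul, Pi.smul_apply, RingHom.id_apply] }
  have hLc : Continuous L :=
    ((PiLp.continuous_apply 2 (fun _ : S => W) c).comp (WithLp.continuous_fst 2 (PiLp 2 (fun _ : S => W)) Λ)).comp U.continuous
  have hK : IsClosed (((ℂ ∙ a c).comap L : Submodule ℂ G) : Set G) :=
    (Submodule.closed_of_finiteDimensional (ℂ ∙ a c)).preimage hLc
  have hsub : Submodule.span ℂ s ≤ (ℂ ∙ a c).comap L := Submodule.span_le.2 fun y hy => by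
    obtain ⟨t, ht⟩ := h y hy
    exact Submodule.mem_comap.2 (Submodule.mem_span_singleton.2 ⟨t, ht.symm⟩)
  have hcl : (Submodule.span ℂ s).topologicalClosure ≤ (ℂ ∙ a c).comap L := (Submodule.span ℂ s).topologicalClosure_minimal hsub hK
  intro y
  have hy : y ∈ (ℂ ∙ a c).comap L := hcl (hs ▸ Submodule.mem_top)
  obtain ⟨t, ht⟩ := Submodule.mem_span_singleton.1 (Submodule.mem_comap.1 hy)
  exact ⟨t, ht.symm⟩

end Atoms

end Summit.HodgeConjecture.HodgeConjecture.R90.S8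

end
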